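import Summits.ResolutionOfSingularities.ResolutionOfSingularities.Theorems.MarkedTransferCampaignW24ReducedRunImmortalSeven
import HarnessLib

/-!
# IMMORTAL UNIVERSAL RUNS AT `p = 5` — `1 + t + 3t³ + 4t⁴` (period 4), `1 + t + 2t² + 4t⁴` (period 3) and the degree-7 carrier
# `3t + t² + t³ + t⁷`: over any field of characteristic 5 their universal reduced Case-(I) runs NEVER DIE
# (HIRONAKA-L, kernel certificates in the OURS reduced model of slot W2.4 / RD-2′ (`CampaignW24.ReducedRun`); res-type-059 g14;
# companion of `…ReducedRunImmortalSeven.lean`; the two IMMORTAL cycle classes of the exact census kit j279501, `p = 5`, `deg ≤ 8`: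
# 21 376 of 390 624 carriers are certified immortal, 364 960 die, 4 288 stay open at the guards)

**HONEST FRAMING.** OURS throughout: kernel theorems about the one-variable reduced model (`univRun`,
`MarkedTransferCampaignW24ReducedRunUniversal.lean`, res-D-pv-035 AS res-L1-k24). Nothing below is a statement of [Hironaka2017]
(lit key `paper:url-3343fd9e678b`), nothing asserts that any statement of it holds, nothing is a claim about resolution of
singularities in characteristic `p`; the manuscript stays «under review» (D-0012/D-0089). AI work, weaker than expert review.

## What is proved (`K` any field with `CharP K 5`; every certificate hypothesis by `decide` / `decide +kernel`)
* `univRun_ne_zero_of_listEntry` (any `p`): a carrier whose list run reaches a state with bottom digit `≡ −1 (mod q)` and contracted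
  bottom class `c·S(λu)` for an `S` whose run never dies, never dies either.
* `univRun_ne_zero_five` (`S₅ = 1 + t + 3t³ + 4t⁴`: four certified states, state 4 at digit `4` with contracted class `S₅(4u)`),
  `univRun_ne_zero_five'` (`1 + t + 2t² + 4t⁴`: three states, contracted class `3·S(2u)`), `univRun_ne_zero_carrier_five`
  (`3t + t² + t³ + t⁷`, `g₀(0) = 0`: three states, contracted class `S₅(3u)`), `order_univRun_five` (digit `5^{a+1} − 1` at state
  `4a + 4`) and `canonRun_five_eq_zero` (exhausted in box at every depth `5^{a+1}`).
So «the universal run of every polynomial dies» — a TREE THEOREM at `p = 2` (res-L1-type-o6) and TRUE for all 531 440 carriers of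
degree `≤ 12` at `p = 3` (kit j279500, exact) — is FALSE at `p = 5` and at `p = 7` (this file and its companion). OURS objects only.
Hypotheses: none beyond `[CharP K p]`; no FACT-LIST fact, no DEFECT binder; no new definitions. Standard axioms.
-/

noncomputable section

set_option linter.dupNamespace false -- mandated namespace of this single-conjunct summit

namespace Summit.ResolutionOfSingularities.ResolutionOfSingularities.Theorems

namespace CampaignW24

namespace ReducedRun

open PowerSeries

universe u

/-! ## Entering a certified cycle (any prime) -/

section Entry

variable {K : Type u} [Field K] (p : ℕ) [hp : Fact p.Prime] [CharP K p]

/-- **IMMORTALITY BY ENTERING A CYCLE (any prime `p`).** If the list run from `T` along `steps` is legal, ends at a list `G` with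
bottom index `q·j₀ + (q−1)` (`q = p^a`) whose contracted bottom class is `c·S(λu)` (finite check, residues `c, λ ≢ 0`), and the
universal run from `ofList S` never dies, then the universal run from `ofList T` never dies. [folklore] -/
theorem univRun_ne_zero_of_listEntry {fuel a j₀ c l R : ℕ} {T S : List ℕ} {steps : List (ℕ × ℕ)}
    (hrun : runOK p fuel T steps = true)
    (hord : (∀ m < p ^ a * j₀ + (p ^ a - 1), lget (lrunWith p fuel T steps) m % p = 0) ∧
      lget (lrunWith p fuel T steps) (p ^ a * j₀ + (p ^ a - 1)) % p ≠ 0)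
    (hc : c % p ≠ 0) (hl : l % p ≠ 0) (hA : (lrunWith p fuel T steps).length ≤ p ^ a * R + (p ^ a - 1))
    (hS : S.length ≤ R)
    (hcls : ∀ r < R, c * l ^ r * lget S r % p = lget (lrunWith p fuel T steps) (p ^ a * r + (p ^ a - 1)) % p)
    (hSrun : ∀ n : ℕ, univRun (ofList S : K⟦X⟧) n ≠ 0) : ∀ n : ℕ, univRun (ofList T : K⟦X⟧) n ≠ 0 := by
  have hG := univRun_ofList (K := K) p steps T hrun
  have hGord := order_ofList (K := K) p hord.1 hord.2
  have hcls' := coeff_C_mul_rescale_ofList (K := K) p hA hS hcls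
  have hcK := natCast_ne_zero_of_mod (K := K) p hc
  have hlK := natCast_ne_zero_of_mod (K := K) p hl
  have hG0 : univRun (ofList T : K⟦X⟧) steps.length ≠ 0 := fun h => by
    have := (order_eq_nat.mp hGord).1
    rw [← hG, h, map_zero] at this
    exact this rfl
  intro n hn
  by_cases hle : n ≤ steps.length
  · exact hG0 (univRun_eq_zero_of_le _ hn hle)
  · obtain ⟨m, rfl⟩ := Nat.exists_eq_add_of_lt (lt_of_not_ge hle)
    have hm : univRun (univRun (ofList T : K⟦X⟧) steps.length) (m + 1) = 0 := by
      rw [← univRun_add, ← add_assoc, hn]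
    rw [hG, univRun_eq_zero_iff p hGord hcls' (m + 1), univRun_C_mul_rescale hcK hlK,
      C_mul_rescale_eq_zero_iff hcK hlK] at hm
    exact hSrun (m + 1) hm

end Entry

/-! ## The instances at `p = 5` -/

section Five

variable {K : Type u} [Field K] [CharP K 5]

/-- **IMMORTALITY AT `p = 5`, period 4.** Over every field of characteristic `5`, the universal reduced Case-(I) run from
`S₅ = 1 + t + 3t³ + 4t⁴` never dies (four certified list states with bottom indices `0,1,2,3`; state 4 at the boundary digit `4`,
contracted bottom class `S₅(4u)`). OURS (reduced model). [folklore] -/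
theorem univRun_ne_zero_five (n : ℕ) : univRun (ofList [1, 1, 0, 3, 4] : K⟦X⟧) n ≠ 0 := by
  haveI : Fact (Nat.Prime 5) := ⟨by norm_num⟩
  exact univRun_ne_zero_of_listCycle (K := K) 5 (fuel := 3) (a := 1) (j₀ := 0) (c := 1) (l := 4) (R := 13)
    (steps := [(0, 1), (1, 4), (2, 3), (3, 3)]) (by decide) (by decide +kernel) (by decide +kernel) (by decide) (by decide)
    (by decide +kernel) (by decide +kernel) (by decide +kernel) n

/-- **IMMORTALITY AT `p = 5`, period 3.** The universal run from `1 + t + 2t² + 4t⁴` never dies (three certified states; state 3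
at digit `4`, contracted bottom class `3·S(2u)`). OURS (reduced model). [folklore] -/
theorem univRun_ne_zero_five' (n : ℕ) : univRun (ofList [1, 1, 2, 0, 4] : K⟦X⟧) n ≠ 0 := by
  haveI : Fact (Nat.Prime 5) := ⟨by norm_num⟩
  exact univRun_ne_zero_of_listCycle (K := K) 5 (fuel := 3) (a := 1) (j₀ := 0) (c := 3) (l := 2) (R := 7)
    (steps := [(0, 1), (1, 4), (2, 1)]) (by decide) (by decide +kernel) (by decide +kernel) (by decide) (by decide)
    (by decide +kernel) (by decide +kernel) (by decide +kernel) n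

/-- **IMMORTALITY OF A DEGREE-7 CARRIER AT `p = 5`.** The universal run from `3t + t² + t³ + t⁷` (constant term `0`; one of the
4 144 certified-immortal carriers of degree 7 in kit j279501) never dies: after three certified states it sits at digit `4` with
contracted bottom class `S₅(3u)`. OURS (reduced model). [folklore] -/
theorem univRun_ne_zero_carrier_five (n : ℕ) : univRun (ofList [0, 3, 1, 1, 0, 0, 0, 1] : K⟦X⟧) n ≠ 0 := by
  haveI : Fact (Nat.Prime 5) := ⟨by norm_num⟩
  exact univRun_ne_zero_of_listEntry (K := K) 5 (fuel := 3) (a := 1) (j₀ := 0) (c := 1) (l := 3) (R := 10)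
    (S := [1, 1, 0, 3, 4]) (steps := [(1, 2), (2, 2), (3, 1)]) (by decide +kernel) (by decide +kernel) (by decide) (by decide)
    (by decide +kernel) (by decide +kernel) (by decide +kernel) univRun_ne_zero_five n

/-- **EVERY BOUNDARY DIGIT IS VISITED** (`p = 5`): the run from `S₅` has bottom digit `5^{a+1} − 1` at state `4a + 4`, for every
`a` (digits `0,1,2,3,4, 9,14,19,24, 49,…,124, …`). [folklore] -/
theorem order_univRun_five : ∀ a : ℕ, order (univRun (ofList [1, 1, 0, 3, 4] : K⟦X⟧) (4 * a + 4)) = (5 ^ (a + 1) - 1 : ℕ)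
  | 0 => by
    haveI : Fact (Nat.Prime 5) := ⟨by norm_num⟩
    rw [show 4 * 0 + 4 = [(0, 1), (1, 4), (2, 3), (3, 3)].length by decide,
      univRun_ofList (K := K) 5 (fuel := 3) [(0, 1), (1, 4), (2, 3), (3, 3)] [1, 1, 0, 3, 4] (by decide +kernel)]
    exact order_ofList (K := K) 5 (by decide +kernel) (by decide +kernel)
  | a + 1 => by
    haveI : Fact (Nat.Prime 5) := ⟨by norm_num⟩
    have h := order_univRun_of_listCycle (K := K) 5 (fuel := 3) (a := 1) (j₀ := 0) (c := 1) (l := 4) (R := 13)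
      (S := [1, 1, 0, 3, 4]) (steps := [(0, 1), (1, 4), (2, 3), (3, 3)]) (by decide +kernel) (by decide +kernel) (by decide)
      (by decide) (by decide +kernel) (by decide +kernel) (by decide +kernel) (4 * a + 4) (order_univRun_five a)
    rw [show 4 * (a + 1) + 4 = [(0, 1), (1, 4), (2, 3), (3, 3)].length + (4 * a + 4) by simp; ring, h]
    congr 1
    have : 1 ≤ 5 ^ (a + 1) := Nat.one_le_pow _ _ (by norm_num)
    rw [pow_succ 5 (a + 1)]
    omega

/-- **… YET EXHAUSTED IN BOX AT EVERY DEPTH** (`p = 5`): the canonical depth-`5^{a+1}` run from `S₅` is exactly `0` at state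
`4a + 5`, for every `a`. [folklore] -/
theorem canonRun_five_eq_zero (a : ℕ) : canonRun (5 ^ (a + 1)) (ofList [1, 1, 0, 3, 4] : K⟦X⟧) (4 * a + 4 + 1) = 0 := by
  haveI : Fact (Nat.Prime 5) := ⟨by norm_num⟩
  refine canonRun_succ_eq_zero_of_univDigit 5 (EqBelow.refl _) (4 * a + 4) (fun j hj => ?_) (order_univRun_five a)
  obtain ⟨k, hk⟩ := exists_order_eq_nat (univRun_ne_zero_five (K := K) j)
  refine ⟨k, hk, ?_⟩
  have hlt := order_univRun_lt_of_lt 5 (ofList [1, 1, 0, 3, 4] : K⟦X⟧) hj (univRun_ne_zero_five _)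
  rw [hk, order_univRun_five a, Nat.cast_lt] at hlt
  omega

end Five

end ReducedRun

end CampaignW24

end Summit.ResolutionOfSingularities.ResolutionOfSingularities.Theorems

end
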